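import Literature.NumberTheory.NumberFields.OddPrimePowerKW
import Literature.NumberTheory.GaloisRepresentations.TameInertiaProofs
import HarnessLib

/-!
# Absorbing a tamely ramified prime into a cyclotomic field (Marcus, Ch. 4, Ex. 31)

The reduction step of the Hilbert–Speiser proof of the Kronecker–Weber theorem which removes the
ramified primes `q ≠ p` of an abelian field of `p`-power degree one at a time (Marcus, *Number
Fields*, Ch. 4, Ex. 31: "Let `U` be a prime of `KL` lying over `Q`, and let `K'` denote the
inertia field … Use (g) to show that `K'L = KL`"), inside an ambient abelian number field `M₀`
with group `G`, subfields being tracked by their groups `H_F = Gal(M₀/F)` and ramification by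
inertia subgroups of `G` (`UnramifiedViaInertia.lean`).

* `relIndex_inertia_eq_ramificationIdx_under` — `e(Q ∩ 𝓞 F | ℤ) = [I(Q) : I(Q) ∩ H_F]`.
* `inertia_eq_inertia_of_mem` — in an abelian field the primes above `q` share their inertia group.
* `tame_structure` — for `Q ∋ q`: `G₁(Q)` is a `q`-group, `I(Q)/G₁(Q)` is cyclic, and
  `[I(Q) : G₁(Q)] ∣ q - 1` (tree: `Ideal.isPGroup_ramificationSubgroup_one`, the maps `θ₀` and
  Marcus Ex. 26(c) of `RamificationFiltrationQuotients.lean`).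
* `exists_tame_absorption` — for `F ≤ M₀` of `p`-power degree, a prime `q ≠ p` and
  `Cyq = ℚ(ζ_q) ≤ M₀`: there is `K' ≤ M₀` of `p`-power degree with `F ≤ K' ℚ(ζ_q)`, `q`
  unramified in `K'`, and every prime `∤ q` unramified in `F` unramified in `K'`.  With
  `e = e_q(F)` (`∣ p^m` and `∣ q - 1`, as `G₁(Q) ≤ H_F`), `L ≤ ℚ(ζ_q)` the subfield of degree `e`
  (`Gal(ℚ(ζ_q)/ℚ)` cyclic of order `q - 1`, `q` totally ramified in it), the heart is
  `I(Q) ∩ H_F = I(Q) ∩ H_L`: both have index `e` in `I(Q)` and contain `G₁(Q)`, and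
  `I(Q)/G₁(Q)` is cyclic (`Subgroup.eq_of_index_eq_of_isCyclic`); then
  `K' = M₀^{(H_F ∩ H_L) I(Q)}` works.

## References

* D. A. Marcus, *Number Fields*, 2nd ed., Universitext, Springer (2018), Ch. 4, Ex. 26, 31
  (pp. 100–101). [Marcus2018]
-/

noncomputable section

open NumberField Ideal
open scoped Pointwise IsMulCommutative

namespace Literature.NumberTheory.NumberFields

variable {M₀ : Type*} [Field M₀] [NumberField M₀]

/-! ### The ramification index of the prime of a subfield below `Q`, via inertia groups -/

/-- For a subfield `F` of the Galois number field `M₀` and a maximal ideal `Q` of `𝓞 M₀`: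
`e(Q ∩ 𝓞 F | ℤ) = [I(Q) : I(Q) ∩ Gal(M₀/F)]` (`= Gal(M₀/F).relIndex I(Q)`), from
`e(Q|ℤ) = e(Q_F|ℤ) e(Q|Q_F)`, `e(Q|ℤ) = #I(Q)`, `e(Q|Q_F) = #(I(Q) ∩ Gal(M₀/F))`.
Ref: Serre, *Local Fields*, Ch. I §7, Prop. 22. [folklore] -/
theorem relIndex_inertia_eq_ramificationIdx_under [IsGalois ℚ M₀] (F : IntermediateField ℚ M₀)
    (Q : Ideal (𝓞 M₀)) [Q.IsMaximal] :
    F.fixingSubgroup.relIndex (Q.inertia (M₀ ≃ₐ[ℚ] M₀)) = (Q.under (𝓞 F)).ramificationIdx ℤ := by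
  haveI : IsGaloisGroup F.fixingSubgroup F M₀ :=
    IsGaloisGroup.intermediateField (M₀ ≃ₐ[ℚ] M₀) ℚ M₀ F
  haveI : (Q.under (𝓞 F)).IsMaximal := Ideal.IsMaximal.under (𝓞 F) Q
  have htower := ramificationIdx_tower (R := ℤ) (Q.under (𝓞 F)) Q
  rw [← card_inertia_eq_ramificationIdx_int M₀ (M₀ ≃ₐ[ℚ] M₀) Q,
    ← card_inertia_eq_ramificationIdx M₀ F.fixingSubgroup F Q,
    card_inertia_eq_card_inf_range M₀ Q F.fixingSubgroup.subtype F.fixingSubgroup.subtype_injective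
      (fun _ _ => rfl), Subgroup.range_subtype] at htower
  have h2 : Nat.card (Q.inertia (M₀ ≃ₐ[ℚ] M₀)) =
      F.fixingSubgroup.relIndex (Q.inertia (M₀ ≃ₐ[ℚ] M₀)) *
        Nat.card (Q.inertia (M₀ ≃ₐ[ℚ] M₀) ⊓ F.fixingSubgroup : Subgroup (M₀ ≃ₐ[ℚ] M₀)) := by
    rw [Subgroup.relIndex, inf_comm, ← Subgroup.subgroupOf_map_subtype,
      Subgroup.card_map_of_injective (Subgroup.subtype_injective _), mul_comm,
      Subgroup.card_mul_index]
  rw [h2] at htower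
  exact Nat.eq_of_mul_eq_mul_right Nat.card_pos htower

/-! ### Inertia groups of the primes above a fixed rational prime, in an abelian extension -/

/-- In an abelian number field all maximal ideals containing the rational prime `q` have the same
inertia group. [folklore] -/
theorem inertia_eq_inertia_of_mem [IsAbelianGalois ℚ M₀] {q : ℕ} (hq : q.Prime)
    (Q Q' : Ideal (𝓞 M₀)) [Q.IsMaximal] [Q'.IsMaximal] (hQ : (q : 𝓞 M₀) ∈ Q)
    (hQ' : (q : 𝓞 M₀) ∈ Q') : Q'.inertia (M₀ ≃ₐ[ℚ] M₀) = Q.inertia (M₀ ≃ₐ[ℚ] M₀) := by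
  haveI hqmax : (Ideal.span {(q : ℤ)}).IsMaximal :=
    Ideal.IsPrime.isMaximal
      ((Ideal.span_singleton_prime (by exact_mod_cast hq.ne_zero)).mpr
        (Nat.prime_iff_prime_int.mp hq)) (by simpa using hq.ne_zero)
  have hunder : ∀ (P : Ideal (𝓞 M₀)) [P.IsMaximal], (q : 𝓞 M₀) ∈ P →
      P.LiesOver (Ideal.span {(q : ℤ)}) := by
    intro P _ hP
    refine ⟨(hqmax.eq_of_le (Ideal.IsMaximal.under ℤ P).ne_top ?_)⟩
    rw [Ideal.span_singleton_le_iff_mem, Ideal.under_def, Ideal.mem_comap, map_natCast]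
    exact hP
  haveI := hunder Q hQ
  haveI := hunder Q' hQ'
  obtain ⟨g, hg⟩ := exists_smul_eq_of_isGaloisGroup (Ideal.span {(q : ℤ)}) Q Q' (M₀ ≃ₐ[ℚ] M₀)
  rw [← hg, inertia_smul_eq_of_isMulCommutative]

/-! ### Tame structure of a prime of an abelian number field -/

section Tame

variable [IsAbelianGalois ℚ M₀]

/-- **Tame inertia in an abelian number field.**  For a maximal ideal `Q ∋ q` of `𝓞 M₀`
(`M₀` abelian, `G = Gal(M₀/ℚ)`): the first ramification group `V = G₁(Q)` is a `q`-group
(`Ideal.isPGroup_ramificationSubgroup_one`), the quotient `I(Q)/V` is cyclic (`θ₀`,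
`exists_monoidHom_ramificationSubgroup_zero_units`), and `[I(Q) : V] ∣ q - 1`
(`relIndex_ramificationSubgroup_one_dvd_of_commute`, Marcus Ch. 4 Ex. 26(c)).
[cite: Marcus2018, Ch. 4, Ex. 21, 23, 26 (pp. 99–100)] -/
theorem tame_structure {q : ℕ} (hq : q.Prime) (Q : Ideal (𝓞 M₀)) [Q.IsMaximal]
    (hQ : (q : 𝓞 M₀) ∈ Q) :
    IsPGroup q (Q.ramificationSubgroup (M₀ ≃ₐ[ℚ] M₀) 1) ∧
    IsCyclic ((Q.ramificationSubgroup (M₀ ≃ₐ[ℚ] M₀) 0) ⧸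
      (Q.ramificationSubgroup (M₀ ≃ₐ[ℚ] M₀) 1).subgroupOf (Q.ramificationSubgroup (M₀ ≃ₐ[ℚ] M₀) 0)) ∧
    (Q.ramificationSubgroup (M₀ ≃ₐ[ℚ] M₀) 1).relIndex (Q.ramificationSubgroup (M₀ ≃ₐ[ℚ] M₀) 0) ∣
      q - 1 := by
  classical
  haveI hGal : IsGaloisGroup (M₀ ≃ₐ[ℚ] M₀) ℤ (𝓞 M₀) := inferInstance
  haveI : FaithfulSMul (M₀ ≃ₐ[ℚ] M₀) (𝓞 M₀) := hGal.faithful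
  haveI : Algebra.IsInvariant ℤ (𝓞 M₀) (M₀ ≃ₐ[ℚ] M₀) := hGal.isInvariant
  have hQne : Q ≠ ⊥ := Ideal.IsMaximal.ne_bot_of_isIntegral_int Q
  have hQtop : Q ≠ ⊤ := Ideal.IsMaximal.ne_top inferInstance
  haveI : Finite (𝓞 M₀ ⧸ Q) := Ideal.finiteQuotientOfFreeOfNeBot Q hQne
  letI : Field (𝓞 M₀ ⧸ Q) := Ideal.Quotient.field Q
  refine ⟨Q.isPGroup_ramificationSubgroup_one (M₀ ≃ₐ[ℚ] M₀) hQtop hQ, ?_, ?_⟩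
  · obtain ⟨π, hπ, hπ2⟩ := Ideal.exists_mem_pow_notMem_pow_succ Q hQne hQtop 1
    rw [pow_one] at hπ
    obtain ⟨θ, -, hker⟩ :=
      Literature.NumberTheory.GaloisRepresentations.exists_monoidHom_ramificationSubgroup_zero_units
        (G := M₀ ≃ₐ[ℚ] M₀) hQne hπ hπ2
    haveI : IsCyclic ((Q.ramificationSubgroup (M₀ ≃ₐ[ℚ] M₀) 0) ⧸ θ.ker) :=
      isCyclic_of_surjective (QuotientGroup.quotientKerEquivRange θ).symm.toMonoidHom
        (MulEquiv.surjective _)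
    exact isCyclic_of_surjective (QuotientGroup.quotientMulEquivOfEq hker).toMonoidHom
      (MulEquiv.surjective _)
  · have h := Literature.NumberTheory.GaloisRepresentations.relIndex_ramificationSubgroup_one_dvd_of_commute
      (R := ℤ) (G := M₀ ≃ₐ[ℚ] M₀) hQne (fun φ _ σ _ => mul_comm φ σ)
    -- `#(ℤ/(Q ∩ ℤ)) = q`
    haveI hqmax : (Ideal.span {(q : ℤ)}).IsMaximal :=
      Ideal.IsPrime.isMaximal
        ((Ideal.span_singleton_prime (by exact_mod_cast hq.ne_zero)).mpr
          (Nat.prime_iff_prime_int.mp hq)) (by simpa using hq.ne_zero)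
    have hunder : Q.under ℤ = Ideal.span {(q : ℤ)} := by
      refine (hqmax.eq_of_le (Ideal.IsMaximal.under ℤ Q).ne_top ?_).symm
      rw [Ideal.span_singleton_le_iff_mem, Ideal.under_def, Ideal.mem_comap, map_natCast]
      exact hQ
    have hcard : Nat.card (ℤ ⧸ Q.under ℤ) = q := by
      rw [hunder, Nat.card_congr (Int.quotientSpanNatEquivZMod q).toEquiv, Nat.card_zmod]
    rwa [hcard] at h

/-! ### Absorbing a tamely ramified prime (Marcus, Ch. 4, Ex. 31) -/

/-- **Marcus, *Number Fields*, Ch. 4, Ex. 31 (tame absorption), with the degree bound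
`[K' : ℚ] ∣ [F : ℚ]`.**  Same as `exists_tame_absorption` below, recording moreover that the
`p`-power `[G : H_{K'}] = p^j` satisfies `j ≤ m`: indeed `[G : H_F ∩ H_L] = [G : H_{K'}] · e`
(as `[H_{K'} : H_F ∩ H_L] = [I : I ∩ H_F] = e` by the core identity `I ∩ H_F = I ∩ H_L`) while
`[G : H_F ∩ H_L] ∣ e · p^m` (Marcus: "Also note that `[K' : ℚ]` is a power of `p`"; in his proof
`[K' : ℚ] = [KL : ℚ]/e ≤ p^m`). [cite: Marcus2018, Ch. 4, Ex. 31 (p. 101)] -/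
theorem exists_tame_absorption_le {p : ℕ} (hp : p.Prime) (F : IntermediateField ℚ M₀) {m : ℕ}
    (hF : F.fixingSubgroup.index = p ^ m) {q : ℕ} (hq : q.Prime) (hqp : q ≠ p)
    (Cyq : IntermediateField ℚ M₀) [IsCyclotomicExtension {q} ℚ Cyq] :
    ∃ K' : IntermediateField ℚ M₀, (∃ j, j ≤ m ∧ K'.fixingSubgroup.index = p ^ j) ∧
      F ≤ K' ⊔ Cyq ∧
      (∀ (Q : Ideal (𝓞 M₀)) [Q.IsMaximal], (q : 𝓞 M₀) ∈ Q →
        Q.inertia (M₀ ≃ₐ[ℚ] M₀) ≤ K'.fixingSubgroup) ∧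
      (∀ (Q : Ideal (𝓞 M₀)) [Q.IsMaximal], (q : 𝓞 M₀) ∉ Q →
        Q.inertia (M₀ ≃ₐ[ℚ] M₀) ≤ F.fixingSubgroup → Q.inertia (M₀ ≃ₐ[ℚ] M₀) ≤ K'.fixingSubgroup) := by
  classical
  haveI : Fact q.Prime := ⟨hq⟩
  haveI : NeZero q := ⟨hq.ne_zero⟩
  haveI : IsGalois ℚ Cyq := IsCyclotomicExtension.isGalois {q} ℚ Cyq
  -- a prime `Q₀` above `q`, its inertia group `I` and first ramification group `V`
  haveI hqmax : (Ideal.span {(q : ℤ)}).IsMaximal :=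
    Ideal.IsPrime.isMaximal
      ((Ideal.span_singleton_prime (by exact_mod_cast hq.ne_zero)).mpr
        (Nat.prime_iff_prime_int.mp hq)) (by simpa using hq.ne_zero)
  obtain ⟨Q₀, hQ₀max, hQ₀over⟩ :=
    Ideal.exists_maximal_ideal_liesOver_of_isIntegral (S := 𝓞 M₀) (Ideal.span {(q : ℤ)})
  have hqQ₀ : (q : 𝓞 M₀) ∈ Q₀ := by
    have : algebraMap ℤ (𝓞 M₀) (q : ℤ) ∈ Q₀ :=
      (Ideal.mem_of_liesOver Q₀ (Ideal.span {(q : ℤ)}) (q : ℤ)).mp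
        (Ideal.mem_span_singleton_self _)
    simpa using this
  set I : Subgroup (M₀ ≃ₐ[ℚ] M₀) := Q₀.ramificationSubgroup (M₀ ≃ₐ[ℚ] M₀) 0 with hI
  set V : Subgroup (M₀ ≃ₐ[ℚ] M₀) := Q₀.ramificationSubgroup (M₀ ≃ₐ[ℚ] M₀) 1 with hV
  have hIeq : I = Q₀.inertia (M₀ ≃ₐ[ℚ] M₀) := Ideal.ramificationSubgroup_zero Q₀ (M₀ ≃ₐ[ℚ] M₀)
  have hVI : V ≤ I := Q₀.ramificationSubgroup_antitone (M₀ ≃ₐ[ℚ] M₀) (Nat.zero_le 1)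
  obtain ⟨hVq, hcyc, hIV⟩ := tame_structure (M₀ := M₀) hq Q₀ hqQ₀
  set HF := F.fixingSubgroup with hHF
  set HC := Cyq.fixingSubgroup with hHC
  haveI : HF.Normal := inferInstance
  haveI : HC.Normal := inferInstance
  -- (d) `V ≤ H` whenever `[G : H]` is a power of `p` (`V` is a `q`-group, `q ≠ p`)
  have hVle : ∀ (H : Subgroup (M₀ ≃ₐ[ℚ] M₀)) (j : ℕ), H.index = p ^ j → V ≤ H := by
    intro H j hj v hv
    haveI : H.Normal := inferInstance
    obtain ⟨a, ha⟩ := hVq ⟨v, hv⟩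
    have ha' : v ^ q ^ a = 1 := by
      have := congrArg (fun x : V => (x : M₀ ≃ₐ[ℚ] M₀)) ha
      simpa using this
    have h1 : orderOf (QuotientGroup.mk (s := H) v) ∣ q ^ a :=
      orderOf_dvd_of_pow_eq_one (by rw [← QuotientGroup.mk_pow, ha', QuotientGroup.mk_one])
    have h2 : orderOf (QuotientGroup.mk (s := H) v) ∣ p ^ j := hj ▸ orderOf_dvd_natCard _
    have hcop : Nat.Coprime (q ^ a) (p ^ j) :=
      Nat.Coprime.pow _ _ ((Nat.coprime_primes hq hp).mpr hqp)
    have h3 : orderOf (QuotientGroup.mk (s := H) v) = 1 :=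
      Nat.eq_one_of_dvd_coprimes hcop h1 h2
    exact (QuotientGroup.eq_one_iff v).mp (orderOf_eq_one_iff.mp h3)
  have hVF : V ≤ HF := hVle HF m hF
  -- (e) the ramification index `e = [I : I ∩ H_F]` is a power of `p`
  set e := HF.relIndex I with he
  have hedvd : e ∣ p ^ m := hF ▸ Subgroup.relIndex_dvd_index_of_normal HF I
  obtain ⟨a, -, hea⟩ := (Nat.dvd_prime_pow hp).mp hedvd
  -- (f) `q` is totally ramified in `Cyq`: `I ⊔ H_C = G`
  have hIC : I ⊔ HC = ⊤ := by
    haveI : (Q₀.under (𝓞 Cyq)).IsMaximal := Ideal.IsMaximal.under (𝓞 Cyq) Q₀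
    haveI : (Q₀.under (𝓞 Cyq)).LiesOver (Ideal.span {(q : ℤ)}) := by
      constructor; rw [Ideal.under_under]; exact hQ₀over.over
    have h1 : HC.relIndex I = q - 1 := by
      rw [hIeq, hHC, relIndex_inertia_eq_ramificationIdx_under Cyq Q₀,
        IsCyclotomicExtension.Rat.ramificationIdx_eq_of_prime q Cyq (Q₀.under (𝓞 Cyq))]
    have h2 : HC.index = q - 1 := by
      have h3 := Cyq.fixingSubgroup.card_mul_index
      rw [IsGalois.card_fixingSubgroup_eq_finrank Cyq, IsGalois.card_aut_eq_finrank,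
        ← Module.finrank_mul_finrank ℚ Cyq M₀, mul_comm] at h3
      rw [hHC, Nat.eq_of_mul_eq_mul_right (Module.finrank_pos (R := Cyq) (M := M₀)) h3,
        IsCyclotomicExtension.finrank Cyq (Polynomial.cyclotomic.irreducible_rat hq.pos),
        Nat.totient_prime hq]
    have h4 : (I ⊔ HC).index = 1 := by
      have h5 := Subgroup.relIndex_mul_index (le_sup_right : HC ≤ I ⊔ HC)
      rw [Subgroup.relIndex_sup_right, h1, h2] at h5
      exact (Nat.eq_of_mul_eq_mul_left (by have := hq.two_le; omega) (h5.trans (mul_one _).symm))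
    exact Subgroup.index_eq_one.mp h4
  -- (g) the subfield `L ≤ Cyq` of degree `e`: `H_L ⊇ H_C` of index `e`
  let f : (M₀ ≃ₐ[ℚ] M₀) →* (Cyq ≃ₐ[ℚ] Cyq) := AlgEquiv.restrictNormalHom Cyq
  have hf : Function.Surjective f := AlgEquiv.restrictNormalHom_surjective M₀
  have hker : f.ker = HC := Cyq.restrictNormalHom_ker
  let eC : (M₀ ≃ₐ[ℚ] M₀) ⧸ HC ≃* (Cyq ≃ₐ[ℚ] Cyq) :=
    (QuotientGroup.quotientMulEquivOfEq hker.symm).trans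
      (QuotientGroup.quotientKerEquivOfSurjective f hf)
  have hcardC : Nat.card ((M₀ ≃ₐ[ℚ] M₀) ⧸ HC) = q - 1 := by
    rw [Nat.card_congr eC.toEquiv, IsGalois.card_aut_eq_finrank,
      IsCyclotomicExtension.finrank Cyq (Polynomial.cyclotomic.irreducible_rat hq.pos),
      Nat.totient_prime hq]
  haveI : IsCyclic ((M₀ ≃ₐ[ℚ] M₀) ⧸ HC) := by
    haveI : IsCyclic (Cyq ≃ₐ[ℚ] Cyq) := isCyclic_of_surjective
      (IsCyclotomicExtension.Rat.galEquivZMod q Cyq).symm.toMonoidHom (MulEquiv.surjective _)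
    exact isCyclic_of_surjective eC.symm.toMonoidHom eC.symm.surjective
  set HL : Subgroup (M₀ ≃ₐ[ℚ] M₀) :=
    ((powMonoidHom e : _ →* _).range).comap (QuotientGroup.mk' HC) with hHL
  have hCL : HC ≤ HL := by
    intro g hg
    rw [hHL, Subgroup.mem_comap, QuotientGroup.mk'_apply, (QuotientGroup.eq_one_iff g).mpr hg]
    exact Subgroup.one_mem _
  have heq1 : e ∣ q - 1 :=
    (Subgroup.index_dvd_of_le (H := V.subgroupOf I) (K := HF.subgroupOf I)
      (fun x hx => hVF hx)).trans hIV
  have hHLi : HL.index = e := by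
    rw [hHL, Subgroup.index_comap_of_surjective _ (QuotientGroup.mk'_surjective HC),
      IsCyclic.index_powMonoidHom_range, hcardC, Nat.gcd_eq_right heq1]
  haveI : HL.Normal := inferInstance
  have hVL : V ≤ HL := hVle HL a (hHLi.trans hea)
  -- (h) `[I : I ∩ H_L] = e` (as `I ⊔ H_L = G`)
  have hIL : I ⊔ HL = ⊤ := eq_top_iff.mpr (hIC ▸ sup_le_sup_left hCL I)
  have heL : HL.relIndex I = e := by
    rw [← Subgroup.relIndex_sup_right, hIL, Subgroup.relIndex_top_right, hHLi]
  -- (i) the core: `I ∩ H_F = I ∩ H_L`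
  have hcore : HF ⊓ I = HL ⊓ I := by
    rw [← Subgroup.subgroupOf_inj]
    -- both have index `e` in `I`, both contain `V`, and `I/V` is cyclic
    set V' := V.subgroupOf I with hV'
    haveI : V'.Normal := inferInstance
    have hleF : (QuotientGroup.mk' V').ker ≤ HF.subgroupOf I := by
      rw [QuotientGroup.ker_mk']; exact fun x hx => hVF hx
    have hleL : (QuotientGroup.mk' V').ker ≤ HL.subgroupOf I := by
      rw [QuotientGroup.ker_mk']; exact fun x hx => hVL hx
    have hmap : (HF.subgroupOf I).map (QuotientGroup.mk' V') =
        (HL.subgroupOf I).map (QuotientGroup.mk' V') := by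
      apply Subgroup.eq_of_index_eq_of_isCyclic
      rw [Subgroup.index_map_eq _ (QuotientGroup.mk'_surjective V') hleF,
        Subgroup.index_map_eq _ (QuotientGroup.mk'_surjective V') hleL]
      change HF.relIndex I = HL.relIndex I
      rw [← he, heL]
    rw [← Subgroup.comap_map_eq_self hleF, ← Subgroup.comap_map_eq_self hleL, hmap]
  -- (j) the field `K'`: `H_{K'} = (H_F ⊓ H_L) ⊔ I`
  set HK : Subgroup (M₀ ≃ₐ[ℚ] M₀) := (HF ⊓ HL) ⊔ I with hHK
  refine ⟨IntermediateField.fixedField HK, ?_, ?_, ?_, ?_⟩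
  · -- `[G : H_{K'}] · e = [G : H_F ⊓ H_L]`, which divides `e · p^m`
    rw [IntermediateField.fixingSubgroup_fixedField]
    haveI : (HF ⊓ HL).Normal := inferInstance
    have h1 : e * HK.index = (HF ⊓ HL).index := by
      rw [← Subgroup.relIndex_mul_index (le_sup_left : HF ⊓ HL ≤ HK), hHK,
        Subgroup.relIndex_sup_left, ← Subgroup.inf_relIndex_right (HF ⊓ HL) I,
        show HF ⊓ HL ⊓ I = HF ⊓ I by rw [inf_assoc, ← hcore, ← inf_assoc, inf_idem],
        Subgroup.inf_relIndex_right, ← he]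
    have h2 : (HF ⊓ HL).index ∣ HL.index * HF.index := by
      rw [← Subgroup.relIndex_mul_index (inf_le_left : HF ⊓ HL ≤ HF), Subgroup.inf_relIndex_left]
      exact Nat.mul_dvd_mul_right (Subgroup.relIndex_dvd_index_of_normal HL HF) _
    rw [hHLi, hF, ← h1] at h2
    have he0 : 0 < e := Nat.pos_of_ne_zero (by rw [hea]; exact pow_ne_zero _ hp.ne_zero)
    obtain ⟨j, hjm, hj⟩ := (Nat.dvd_prime_pow hp).mp (Nat.dvd_of_mul_dvd_mul_left he0 h2)
    exact ⟨j, hjm, hj⟩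
  · -- `F ≤ K' ⊔ Cyq`, i.e. `H_{K'} ⊓ H_C ≤ H_F`
    have hsub : HK ⊓ HC ≤ HF := by
      rintro x ⟨hxK, hxC⟩
      obtain ⟨c, hc, i, hi, rfl⟩ := Subgroup.mem_sup.mp hxK
      have hiL : i ∈ HL := by
        have : c⁻¹ * (c * i) ∈ HL := HL.mul_mem (HL.inv_mem hc.2) (hCL hxC)
        rwa [inv_mul_cancel_left] at this
      have hiF : i ∈ HF := by
        have : i ∈ HL ⊓ I := ⟨hiL, hi⟩
        rw [← hcore] at this
        exact this.1
      exact HF.mul_mem hc.1 hiF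
    calc F = IntermediateField.fixedField HF := (IsGalois.fixedField_fixingSubgroup F).symm
      _ ≤ IntermediateField.fixedField
            ((IntermediateField.fixedField HK ⊔ Cyq).fixingSubgroup) :=
          IntermediateField.fixedField_le (by
            rwa [IntermediateField.fixingSubgroup_sup, IntermediateField.fixingSubgroup_fixedField])
      _ = IntermediateField.fixedField HK ⊔ Cyq := IsGalois.fixedField_fixingSubgroup _
  · intro Q _ hqQ
    rw [IntermediateField.fixingSubgroup_fixedField, inertia_eq_inertia_of_mem hq Q₀ Q hqQ₀ hqQ,
      ← hIeq]
    exact le_sup_right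
  · intro Q _ hqQ hQF
    rw [IntermediateField.fixingSubgroup_fixedField]
    refine le_trans (le_inf hQF ?_) le_sup_left
    -- `L ≤ Cyq` is unramified at `Q ∌ q`
    refine le_trans ?_ hCL
    rw [hHC, ← isUnramifiedAt_under_iff_inertia_le M₀ Cyq Q]
    haveI : (Q.under (𝓞 Cyq)).IsMaximal := Ideal.IsMaximal.under (𝓞 Cyq) Q
    refine isUnramifiedAt_of_isCyclotomicExtension (n := q) Cyq (Q.under (𝓞 Cyq)) ?_
    intro r hr hrQ hdvd
    have hrq : r = q := (Nat.prime_dvd_prime_iff_eq hr hq).mp hdvd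
    subst hrq
    apply hqQ
    rw [Ideal.under_def, Ideal.mem_comap, map_natCast] at hrQ
    exact hrQ

/-- **Marcus, *Number Fields*, Ch. 4, Ex. 31 (c)–(h): absorbing a tamely ramified prime.**  Let
`M₀` be an abelian number field with group `G`, `F ≤ M₀` a subfield of `p`-power degree, `q ≠ p`
a prime, and `Cyq = ℚ(ζ_q) ≤ M₀`.  Then there is a subfield `K' ≤ M₀` of `p`-power degree with
`F ≤ K' · Cyq`, in which `q` is unramified (`I(Q) ≤ Gal(M₀/K')` for all `Q ∋ q`) and in which every
prime `≠ q` unramified in `F` stays unramified.  (`K'` is the inertia field at `q` of `F L`, `L`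
the subfield of `ℚ(ζ_q)` of degree `e = e_q(F)`; the point is `K'L = FL`, i.e.
`I(Q) ∩ Gal(M₀/F) = I(Q) ∩ Gal(M₀/L)`: both have index `e` in `I(Q)` and contain `G₁(Q)`, and
`I(Q)/G₁(Q)` is cyclic.) [cite: Marcus2018, Ch. 4, Ex. 31 (p. 101)] -/
theorem exists_tame_absorption {p : ℕ} (hp : p.Prime) (F : IntermediateField ℚ M₀) {m : ℕ}
    (hF : F.fixingSubgroup.index = p ^ m) {q : ℕ} (hq : q.Prime) (hqp : q ≠ p)
    (Cyq : IntermediateField ℚ M₀) [IsCyclotomicExtension {q} ℚ Cyq] :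
    ∃ K' : IntermediateField ℚ M₀, (∃ j, K'.fixingSubgroup.index = p ^ j) ∧ F ≤ K' ⊔ Cyq ∧
      (∀ (Q : Ideal (𝓞 M₀)) [Q.IsMaximal], (q : 𝓞 M₀) ∈ Q →
        Q.inertia (M₀ ≃ₐ[ℚ] M₀) ≤ K'.fixingSubgroup) ∧
      (∀ (Q : Ideal (𝓞 M₀)) [Q.IsMaximal], (q : 𝓞 M₀) ∉ Q →
        Q.inertia (M₀ ≃ₐ[ℚ] M₀) ≤ F.fixingSubgroup → Q.inertia (M₀ ≃ₐ[ℚ] M₀) ≤ K'.fixingSubgroup) := by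
  obtain ⟨K', ⟨j, -, hj⟩, h⟩ := exists_tame_absorption_le hp F hF hq hqp Cyq
  exact ⟨K', ⟨j, hj⟩, h⟩

end Tame

end Literature.NumberTheory.NumberFields
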